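/-
Copyright (c) 2026. H413 campaign `hodgecm-mathlib`, squad K2, seat K2E1-p11 (gen 0).  Lane: `--supports stmt-HodgeConjecture-24833 --as helper` (count-neutral).
Deal (13′)∕(26) of the dealer K2E1-plan (g6): the CM corollary `hK1_cm_two` — the closer's `hK1` letter at a GIVEN level `c₀`, for `h = η ∗ η`.
-/
import Summits.HodgeConjecture.HodgeConjecture.Theorems.K2E1TruncatedCuspConstantTermTileDataU2    -- ★ (this seat): tile data + the bridge ★ `hK1_of_ae_borelConstantTerm_eq_zero`
import Summits.HodgeConjecture.HodgeConjecture.Theorems.K2E1TruncatedCuspBandBoundU2              -- ★ (25) BAND (K2E1-p02 g6, p859263): `exists_band_bound_cm_two`, the band∕high combinator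
import Literature.NumberTheory.Automorphic.UnitaryGroupHeisenbergHaar                           -- ★ `locallyCompactSpace_traceZeroAdele`
import HarnessLib

/-!
# K1-L² for `U(1,1)`: `hK1_cm_two` — the cusp decay of `R(η ∗ η)` on `𝓗_k^cusp(Z_{c₁})` at a GIVEN level `c₀`, from the band bound and the constant-term a.e. vanishing

sorry-free · THEOREMS ONLY · lane `--supports stmt-HodgeConjecture-24833 --as helper`.

* §1 (any locally compact group) `S_η η` is continuous (dominated convergence) with compact support (`⊆ supp η·supp η`) — the inputs `hhc`∕`hhs` of ★ (25) `exists_band_bound_cm_two`;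
* §2 (CM, `N = 2`) **`hK1_cm_two_of`** — ★ `hK1_of_ae_borelConstantTerm_eq_zero` (the whole K1-L² chain) with `νV := addHaar` on `𝔸_L⁻`, its letter `hii` INSTANTIATED at the tile data
  `νN = n_* νV`, `𝓕 = (n(𝓕⁻))⁻¹` (★ `K2E1TruncatedCuspConstantTermTileDataU2`: Haar, inversion∕right invariant, `N(F)`-fundamental, `νN 𝓕 ∉ {0,∞}`) from an every-`(νN, 𝓕)`
  cuspidality statement `hcuspN` (= K2-defs1's ★-bound `ae_borelConstantTerm_indicator_comp_eq_zero_of_mem_HNcusp`, 10:04:49Z bytes), then the BAND ★ (25) `exists_band_bound_cm_two`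
  (K2E1-p02) below the ceiling `c⋆` and the combinator ★ `ae_norm_rightConvFun_le_of_band_of_high`.  OUTPUT = the closer's `hK1` bytes (★ K2
  `isCompactOperator_deltaShift_comp_subtypeL_HNcusp_of_cusp_decay`) at the given `c₀`, conditional on `hβ`∕`hμZ`, `hcuspN`, and the comparison clause `hΩ` of ★ `exists_heckePackage′`.
[cite: BernsteinLapid2019, §4 Claims 4–5 (p. 10)] [cite: MoeglinWaldspurger1995, I.2.13]
-/

noncomputable section

set_option autoImplicit false

set_option linter.dupNamespace false

open NumberField IsDedekindDomain MeasureTheory Measure Set Function Filter Topology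
open scoped NNReal MatrixGroups Pointwise ENNReal Classical

namespace Summit.HodgeConjecture.HodgeConjecture.Cruxes.H413.K2E1TruncatedCuspDecayHK1CMTwo

open Literature.MeasureTheory.Group Literature.NumberTheory.Automorphic Literature.NumberTheory.Automorphic.UnitaryGroup AdelicGroupData
open Summit.HodgeConjecture.HodgeConjecture.Cruxes.H413.K2E1SiegelRadicalChartU2
open Summit.HodgeConjecture.HodgeConjecture.Cruxes.H413.K2E1BLBorelSpacesU2Defs
open Summit.HodgeConjecture.HodgeConjecture.Cruxes.H413.K2E1BLBorelOperatorsU2Defs (rightConvFun)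
open Summit.HodgeConjecture.HodgeConjecture.Cruxes.H413.K2E1BLIotaUnfoldingU (measurable_borelQuotHeight continuous_borelQuotHeight)
open Summit.HodgeConjecture.HodgeConjecture.Cruxes.H413.K2E1TruncatedCuspCompactU2 (measurableSet_lt_borelQuotHeight ae_lt_borelQuotHeight_weightedTruncMeasure)
open Summit.HodgeConjecture.HodgeConjecture.Cruxes.H413.K2E1UnipotentHaarNormalisationU2 (isInvInvariant_of_isHaarMeasure_two)
open Summit.HodgeConjecture.HodgeConjecture.Cruxes.H413.K2E1TruncatedCuspConstantTermBridgeU2 (hK1_of_ae_borelConstantTerm_eq_zero)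
open Summit.HodgeConjecture.HodgeConjecture.Cruxes.H413.K2E1TruncatedCuspConstantTermTileDataU2
open Summit.HodgeConjecture.HodgeConjecture.Cruxes.H413.K2E1TruncatedCuspBandBoundU2 (ae_norm_rightConvFun_le_of_band_of_high exists_band_bound_cm_two)

/-! ## §1 `S_η η` is continuous with compact support -/

section Generic

variable {G : Type*} [Group G] [TopologicalSpace G] [IsTopologicalGroup G] [MeasurableSpace G] [BorelSpace G] [SecondCountableTopology G]
  (ν : Measure G) [ν.IsHaarMeasure]

/-- **`S_η η` is continuous** for `η ∈ C_c(G)`: `y ↦ ∫ η(g)η(g⁻¹y) dν(g)`, dominated by `‖η‖_∞·|η|` (Mathlib `continuous_of_dominated`). [folklore] -/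
theorem continuous_orbitalSmoothing_self {η : G → ℂ} (hηc : Continuous η) (hηs : HasCompactSupport η) : Continuous (orbitalSmoothing ν η η) := by
  obtain ⟨M, hM⟩ := hηc.norm.bddAbove_range_of_hasCompactSupport hηs.norm
  have hM' : ∀ g, ‖η g‖ ≤ M := fun g => hM ⟨g, rfl⟩
  have hM0 : 0 ≤ M := (norm_nonneg _).trans (hM' 1)
  change Continuous fun y => ∫ g, η g • η (g⁻¹ • y) ∂ν
  simp only [smul_eq_mul]
  refine continuous_of_dominated (fun y => ?_) (fun y => Eventually.of_forall fun g => ?_) ((hηc.integrable_of_hasCompactSupport hηs).norm.mul_const M) ?_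
  · exact (hηc.mul (hηc.comp (continuous_inv.mul continuous_const))).aestronglyMeasurable
  · rw [norm_mul]
    exact mul_le_mul_of_nonneg_left (hM' _) (norm_nonneg _)
  · exact Eventually.of_forall fun g => continuous_const.mul (hηc.comp (continuous_const.mul continuous_id))

omit [MeasurableSpace G] [BorelSpace G] [SecondCountableTopology G] in
/-- **`S_η η` has compact support** (`⊆ supp η · supp η`, ★ `orbitalSmoothing_self_eq_zero`). [folklore] -/
theorem hasCompactSupport_orbitalSmoothing_self {_ : MeasurableSpace G} (ν : Measure G) {η : G → ℂ} (hηs : HasCompactSupport η) :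
    HasCompactSupport (orbitalSmoothing ν η η) :=
  HasCompactSupport.intro' ((hηs.mul hηs).closure) isClosed_closure fun _ hy =>
    K2E1TruncatedCuspDecayHNU2.orbitalSmoothing_self_eq_zero fun h => hy (subset_closure h)

end Generic

/-! ## §2 The CM corollary `hK1_cm_two` -/

section CM

variable (L : Type) [Field L] [NumberField L] [IsCMField L]

/-- **`hK1_cm_two` — THE CLOSER'S `hK1` LETTER FOR `h = η ∗ η` AT A GIVEN LEVEL `c₀`.**  CM pair `L∕L⁺`, `G = U_{L∕L⁺}(2)`, `ν_G` Haar, inversion- and right-invariant, the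
measure letters of record `hβ`∕`hμZ`, a test function `η₀` on `GL₂(𝔸_L)` (`η = η₀|_G`, `h = S_η η`), levels `c₁` (the cuspidal space) and `c₀ > 0` (the target); TWO letters:
`hcuspN` — the cuspidality of the truncated lift in the leaves' currency for EVERY Haar `νN` on `N(𝔸)` and every `N(F)`-fundamental `𝓕` of positive finite mass (K2-defs1's
`ae_borelConstantTerm_indicator_comp_eq_zero_of_mem_HNcusp`, supplied by `fun νN _ _ _ 𝓕 h𝓕 h0 htop f => that νG νN hconj h𝓕 h0 htop hβ hμZ k c₁ f`), and the comparison
clause `hΩ` with its constant `κ`, `κ·c₁ ≤ c₀` (★ `exists_heckePackage′`; the band ★ `exists_band_bound_cm_two` is discharged inside).  THEN **`∃ C ≥ 0, ∀ f ∈ 𝓗_k^cusp(Z_{c₁}), ‖R(h)f(z)‖ ≤ C·‖f‖·HZ(z)^{−m}` a.e. for `HZ^{−2k}μZ|_{Z_{c₀}}`**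
(`νV := addHaar` on `𝔸_L⁻`; ★ `hK1_of_ae_borelConstantTerm_eq_zero` at `cP := c₁` with the tile data ★; then the band ★ below `c⋆ := max c⋆₀ c₀` and the combinator ★).
[cite: BernsteinLapid2019, §4 Claims 4–5 (p. 10)] [cite: MoeglinWaldspurger1995, I.2.13] -/
theorem hK1_cm_two_of [MeasurableSpace (quasiSplit (↥(maximalRealSubfield L)) L (IsCMField.complexConj L) 2).Adelic] [BorelSpace (quasiSplit (↥(maximalRealSubfield L)) L (IsCMField.complexConj L) 2).Adelic]
    (μZ : Measure (borelQuotient (↥(maximalRealSubfield L)) L (IsCMField.complexConj L) 2)) (νG : Measure (quasiSplit (↥(maximalRealSubfield L)) L (IsCMField.complexConj L) 2).Adelic) [νG.IsHaarMeasure] [νG.IsInvInvariant] [νG.IsMulRightInvariant]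
    [MeasurableSpace (AdeleRing (𝓞 L) L)] [BorelSpace (AdeleRing (𝓞 L) L)] [MeasurableSpace ↥(adelicUnipotent (↥(maximalRealSubfield L)) L (IsCMField.complexConj L) 2)] [BorelSpace ↥(adelicUnipotent (↥(maximalRealSubfield L)) L (IsCMField.complexConj L) 2)]
    {β : (quasiSplit (↥(maximalRealSubfield L)) L (IsCMField.complexConj L) 2).Adelic → ℝ≥0∞} (hβ : IsCoveringWeight ↥((arithmeticBorel (↥(maximalRealSubfield L)) L (IsCMField.complexConj L) 2).map (quasiSplit (↥(maximalRealSubfield L)) L (IsCMField.complexConj L) 2).arithmeticSubgroup.subtype) β)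
    (hμZ : ∀ f : borelQuotient (↥(maximalRealSubfield L)) L (IsCMField.complexConj L) 2 → ℝ≥0∞, Measurable f → ∫⁻ z, f z ∂μZ = ∫⁻ g, β g * f (toBorelQuotient (↥(maximalRealSubfield L)) L (IsCMField.complexConj L) 2 g) ∂νG)
    {η₀ : GL (Fin 2) (AdeleRing (𝓞 L) L) → ℝ} (hη₀ : IsTestFunctionGL 2 L η₀) (k : ℕ) (c₁ c₀ : ℝ≥0) (hc₀ : 0 < c₀)
    (hcuspN : ∀ (νN : Measure ↥(adelicUnipotent (↥(maximalRealSubfield L)) L (IsCMField.complexConj L) 2)) [νN.IsHaarMeasure] [νN.IsInvInvariant] [νN.IsMulRightInvariant] (𝓕 : Set ↥(adelicUnipotent (↥(maximalRealSubfield L)) L (IsCMField.complexConj L) 2)),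
      IsFundamentalDomain ↥(rationalUnipotent (↥(maximalRealSubfield L)) L (IsCMField.complexConj L) 2) 𝓕 νN → νN 𝓕 ≠ 0 → νN 𝓕 ≠ ⊤ → ∀ f : ↥(HNcusp (↥(maximalRealSubfield L)) L (IsCMField.complexConj L) 2 k c₁ μZ), ∀ᵐ g ∂νG, c₁ < borelHeight g →
        borelConstantTerm νN 𝓕 (({z : borelQuotient (↥(maximalRealSubfield L)) L (IsCMField.complexConj L) 2 | c₁ < borelQuotHeight (↥(maximalRealSubfield L)) L (IsCMField.complexConj L) 2 z}.indicator ((f : HN (↥(maximalRealSubfield L)) L (IsCMField.complexConj L) 2 k c₁ μZ) : borelQuotient (↥(maximalRealSubfield L)) L (IsCMField.complexConj L) 2 → ℂ)) ∘ toBorelQuotient (↥(maximalRealSubfield L)) L (IsCMField.complexConj L) 2) g = 0)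
    {κ : ℝ≥0} (hκ : 0 < κ) (hc : κ * c₁ ≤ c₀)
    (hΩ : ∀ z : borelQuotient (↥(maximalRealSubfield L)) L (IsCMField.complexConj L) 2, ∀ y ∈ tsupport (fun y => orbitalSmoothing νG (fun g : (quasiSplit (↥(maximalRealSubfield L)) L (IsCMField.complexConj L) 2).Adelic => ((η₀ (adelicVal (↥(maximalRealSubfield L)) L (IsCMField.complexConj L) 2 ((StdForm.antidiagonal 2).over L) g) : ℝ) : ℂ)) (fun g : (quasiSplit (↥(maximalRealSubfield L)) L (IsCMField.complexConj L) 2).Adelic => ((η₀ (adelicVal (↥(maximalRealSubfield L)) L (IsCMField.complexConj L) 2 ((StdForm.antidiagonal 2).over L) g) : ℝ) : ℂ)) y),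
      borelQuotHeight (↥(maximalRealSubfield L)) L (IsCMField.complexConj L) 2 z ≤ κ * borelQuotHeight (↥(maximalRealSubfield L)) L (IsCMField.complexConj L) 2 (rightShift (↥(maximalRealSubfield L)) L (IsCMField.complexConj L) 2 y z))
    {m : ℝ} (hm : 0 ≤ m) :
    ∃ C : ℝ, 0 ≤ C ∧ ∀ f : ↥(HNcusp (↥(maximalRealSubfield L)) L (IsCMField.complexConj L) 2 k c₁ μZ), ∀ᵐ z ∂(weightedTruncMeasure (↥(maximalRealSubfield L)) L (IsCMField.complexConj L) 2 k c₀ μZ),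
      ‖rightConvFun (↥(maximalRealSubfield L)) L (IsCMField.complexConj L) 2 νG (fun y => orbitalSmoothing νG (fun g : (quasiSplit (↥(maximalRealSubfield L)) L (IsCMField.complexConj L) 2).Adelic => ((η₀ (adelicVal (↥(maximalRealSubfield L)) L (IsCMField.complexConj L) 2 ((StdForm.antidiagonal 2).over L) g) : ℝ) : ℂ)) (fun g : (quasiSplit (↥(maximalRealSubfield L)) L (IsCMField.complexConj L) 2).Adelic => ((η₀ (adelicVal (↥(maximalRealSubfield L)) L (IsCMField.complexConj L) 2 ((StdForm.antidiagonal 2).over L) g) : ℝ) : ℂ)) y) ((f : HN (↥(maximalRealSubfield L)) L (IsCMField.complexConj L) 2 k c₁ μZ) : borelQuotient (↥(maximalRealSubfield L)) L (IsCMField.complexConj L) 2 → ℂ) z‖ ≤ C * ‖f‖ * ((borelQuotHeight (↥(maximalRealSubfield L)) L (IsCMField.complexConj L) 2 z : ℝ)) ^ (-m) := by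
  have hij : (((0 : Fin 2) : Fin 2) : ℕ) + 1 = (((1 : Fin 2) : Fin 2) : ℕ) := rfl
  have hN : 2 = 2 * (((0 : Fin 2) : Fin 2) : ℕ) + 2 := rfl
  haveI : Algebra.IsQuadraticExtension ↥(maximalRealSubfield L) L := IsCMField.isQuadraticExtension L
  haveI := locallyCompactSpace_adeleRing' L
  haveI := locallyCompactSpace_traceZeroAdele (F := ↥(maximalRealSubfield L)) (E := L) (c := IsCMField.complexConj L)
  -- a Haar measure on `𝔸_L⁻` and the tile data
  set νV : Measure ↥(traceZeroAdele (↥(maximalRealSubfield L)) L (IsCMField.complexConj L)) := Measure.addHaar with hνV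
  set n : ↥(traceZeroAdele (↥(maximalRealSubfield L)) L (IsCMField.complexConj L)) → ↥(adelicUnipotent (↥(maximalRealSubfield L)) L (IsCMField.complexConj L) 2) := fun X => middleRootUnipotent hij hN (Multiplicative.ofAdd X) with hn
  haveI : (νV.map n).IsHaarMeasure := isHaarMeasure_map_middleRootUnipotent_two hij hN νV
  haveI : (νV.map n).IsInvInvariant := isInvInvariant_of_isHaarMeasure_two _
  haveI : (νV.map n).IsMulRightInvariant := isMulRightInvariant_map_chart L hij hN νV
  have hii := hcuspN (νV.map n) ((n '' traceZeroFundamentalDomain (↥(maximalRealSubfield L)) L (IsCMField.complexConj L))⁻¹) (isFundamentalDomain_tile L hij hN νV)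
    (map_chart_apply_tile_ne_zero L hij hN νV) (map_chart_apply_tile_ne_top L hij hN νV)
  -- the high bound (the whole K1-L² chain) and the band
  obtain ⟨cstar₀, C, hC, hspec⟩ := hK1_of_ae_borelConstantTerm_eq_zero L hij hN νG νV hβ hμZ hη₀ k c₁ c₁ hii hm
  set cstar : ℝ≥0 := max cstar₀ c₀ with hcs
  -- the band below `c⋆` (★ (25), K2E1-p02): `h = S_η η` is continuous with compact support
  haveI : LocallyCompactSpace (quasiSplit (↥(maximalRealSubfield L)) L (IsCMField.complexConj L) 2).Adelic := locallyCompactSpace_cmDatum_Adelic L 2 ((StdForm.antidiagonal 2).over L)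
  haveI : SecondCountableTopology (quasiSplit (↥(maximalRealSubfield L)) L (IsCMField.complexConj L) 2).Adelic := secondCountableTopology_cmDatum_Adelic L 2 ((StdForm.antidiagonal 2).over L)
  have h2 : Module.finrank ↥(maximalRealSubfield L) L = 2 := Algebra.IsQuadraticExtension.finrank_eq_two _ L
  have hemb : Topology.IsClosedEmbedding (adelicVal (↥(maximalRealSubfield L)) L (IsCMField.complexConj L) 2 ((StdForm.antidiagonal 2).over L)) :=
    (isClosed_adelicUnitaryGroup L ((StdForm.antidiagonal 2).over L)).isClosedEmbedding_subtypeVal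
  have hηGc : Continuous (fun g : (quasiSplit (↥(maximalRealSubfield L)) L (IsCMField.complexConj L) 2).Adelic => ((η₀ (adelicVal (↥(maximalRealSubfield L)) L (IsCMField.complexConj L) 2 ((StdForm.antidiagonal 2).over L) g) : ℝ) : ℂ)) := Complex.continuous_ofReal.comp (hη₀.continuous.comp hemb.continuous)
  have hηGs : HasCompactSupport (fun g : (quasiSplit (↥(maximalRealSubfield L)) L (IsCMField.complexConj L) 2).Adelic => ((η₀ (adelicVal (↥(maximalRealSubfield L)) L (IsCMField.complexConj L) 2 ((StdForm.antidiagonal 2).over L) g) : ℝ) : ℂ)) := (hη₀.hasCompactSupport.comp_isClosedEmbedding hemb).comp_left Complex.ofReal_zero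
  have hhc : Continuous (fun y => orbitalSmoothing νG (fun g : (quasiSplit (↥(maximalRealSubfield L)) L (IsCMField.complexConj L) 2).Adelic => ((η₀ (adelicVal (↥(maximalRealSubfield L)) L (IsCMField.complexConj L) 2 ((StdForm.antidiagonal 2).over L) g) : ℝ) : ℂ)) (fun g : (quasiSplit (↥(maximalRealSubfield L)) L (IsCMField.complexConj L) 2).Adelic => ((η₀ (adelicVal (↥(maximalRealSubfield L)) L (IsCMField.complexConj L) 2 ((StdForm.antidiagonal 2).over L) g) : ℝ) : ℂ)) y) := continuous_orbitalSmoothing_self νG hηGc hηGs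
  have hhs : HasCompactSupport (fun y => orbitalSmoothing νG (fun g : (quasiSplit (↥(maximalRealSubfield L)) L (IsCMField.complexConj L) 2).Adelic => ((η₀ (adelicVal (↥(maximalRealSubfield L)) L (IsCMField.complexConj L) 2 ((StdForm.antidiagonal 2).over L) g) : ℝ) : ℂ)) (fun g : (quasiSplit (↥(maximalRealSubfield L)) L (IsCMField.complexConj L) 2).Adelic => ((η₀ (adelicVal (↥(maximalRealSubfield L)) L (IsCMField.complexConj L) 2 ((StdForm.antidiagonal 2).over L) g) : ℝ) : ℂ)) y) := hasCompactSupport_orbitalSmoothing_self νG hηGs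
  obtain ⟨C_b, hCb, hb⟩ := exists_band_bound_cm_two L h2 νG hβ hμZ k hc₀ cstar hhc hhs hκ hc hΩ
  exact ⟨max (C_b * ((cstar : ℝ)) ^ m) C, hC.trans (le_max_right _ _),
    ae_norm_rightConvFun_le_of_band_of_high hCb hm (fun f => hb (f : HN (↥(maximalRealSubfield L)) L (IsCMField.complexConj L) 2 k c₁ μZ)) (hspec cstar (le_max_left _ _))⟩

end CM

end Summit.HodgeConjecture.HodgeConjecture.Cruxes.H413.K2E1TruncatedCuspDecayHK1CMTwo

end
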